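/-
Copyright (c) 2026 the pub-hodgecm-mathlib formalisation cell (harness21).  Prover seat hodgecm-mathlib-F0P3a-p07 (g19): ROAD «HC-D» (holder F0P2-p01 (g23)),
GLOBAL-FINAL glue (D5(i) ★ regular points + (NG) ★ non-regular switch), 2026-09-02.
-/
import Summits.HodgeConjecture.HodgeConjecture.Theorems.F0P3cStCharTSHCDLieGlobal          -- ★ p852131 (this seat) GLOBAL §4 `…_of_local`
import Summits.HodgeConjecture.HodgeConjecture.Theorems.F0P3cStCharTSHCDRegularPoints       -- ★ p852145 (F0P3-p04) D5(i): `exists_nhds_setLIntegral_etaIota_lt_top`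
import Literature.LinearAlgebra.Matrix.CubicNonRegularTraceZeroDichotomy                    -- (NG) (LH6-p02): `mul_self_eq_zero_or_splitSemisimple_of_trace_eq_zero`
import HarnessLib

/-!
# ROAD «HC-D», GLOBAL-FINAL glue: `|η|^{−1∕2}` locally `∫⁻`-finite on `↥𝔲` from the cusp integrability on `↥A` and the two non-regular local inputs

Cell `pub/hodgecm-mathlib`, crux H413 = `stmt-HodgeConjecture-24833` (lane `--supports … --as helper`), route HCCMUnconditional; ROAD «HC-D» (holder F0P2-p01 (g23),
WORDS #9 «GLOBAL-FINAL glue»).  THEOREMS ONLY; ★-only imports.  HONEST LABEL: HC_CM is proved only modulo the 7 printed citations (2 remaining named inputs: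
hLiu418 = `stmt-HodgeConjecture-24832`, h413 = `stmt-HodgeConjecture-24833`) until rung 0 closes; count-neutral (pays no organ, opens no road).

WHAT IT DOES.  ★ GLOBAL §4 `forall_exists_nhds_setLIntegral_etaInv_lt_top_of_local` takes `hreg` (regular points of `↥𝔲₀`) and `hnonreg` (non-regular `X₀ ≠ 0`).  Here
* `hreg` is DISCHARGED by ★ D5(i) `F0P3cStCharTSHCDRegularPoints.exists_nhds_setLIntegral_etaIota_lt_top` modulo its own input «`hcusp`» (the cusp integrand
  `(↑√√|−4c³ − 27d²|_K)⁻¹` is locally `∫⁻`-finite on the coefficient group `↥A`, `A = {(c, d) | σ c = c, σ d = −d}` — road brick (HC)); the closedness letters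
  `IsClosed ↑𝔲₀`, `IsClosed ↑A` of D5(i) are proved here from `Continuous σ`;
* `hnonreg` is SPLIT by the (NG) switch ★ `mul_self_eq_zero_or_splitSemisimple_of_trace_eq_zero` (`(3 : K) ≠ 0`, `trace X₀ = 0`, `X₀ ≠ 0`, `¬ LinearIndependent K ![1, X₀, X₀²]`
  ⇒ `X₀² = 0` ∨ split semisimple non-scalar) into the two remaining local inputs, kept as hypotheses until ★ in the letters of the (NG) disjuncts:
  `hsq` (square-zero `X₀ ≠ 0` — D5(iii), A-p12) and `hss` (type `(a,a,b)`, `a ≠ b`, non-scalar — D5(ii), F0P3a-p05).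
So after this file the road's Lie-algebra statement depends on exactly three named inputs: (HC) `hcusp`, (iii) `hsq`, (ii) `hss`.

## References
* [HarishChandra1970] Harish-Chandra (notes by G. van Dijk), *Harmonic Analysis on Reductive p-adic Groups*, LNM 162 (1970), Part VII §1 Thm. 15.
* [Folland1999] G. B. Folland, *Real Analysis* (2nd ed., 1999), §11.1 Thm. 11.9.
-/

set_option autoImplicit false
-- the mandated namespace has the single-problem summit's repeated segment (`HodgeConjecture.HodgeConjecture`)
set_option linter.dupNamespace false

noncomputable section

open MeasureTheory MeasureTheory.Measure Filter Topology Set Matrix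
open scoped ENNReal NNReal Topology Matrix
open Literature.NumberTheory.GaloisRepresentations Literature.NumberTheory.Automorphic Literature.MeasureTheory.Group
open Literature.LinearAlgebra.Matrix
open Summit.HodgeConjecture.HodgeConjecture.Cruxes.H413.F0P3cStCharTSHCDLieGlobal
open Summit.HodgeConjecture.HodgeConjecture.Cruxes.H413.F0P3cStCharTSHCDRegularPoints

namespace Summit.HodgeConjecture.HodgeConjecture.Cruxes.H413.F0P3cStCharTSHCDLieGlobalFinal

variable {K : Type*} [Field K] [ValuativeRel K] [TopologicalSpace K] [IsNonarchimedeanLocalField K]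

/-- The trace-zero unitary Lie algebra `𝔲₀` is closed when `σ` is continuous (preimage of `{0}` under continuous maps). [cite: Folland1999, §11.1 Thm. 11.9] -/
theorem isClosed_traceZero {σ : K →+* K} (hσc : Continuous σ) (J : Matrix (Fin 3) (Fin 3) K)
    (𝔲₀ : AddSubgroup (Matrix (Fin 3) (Fin 3) K)) (h𝔲₀ : ∀ X, X ∈ 𝔲₀ ↔ (X.map σ)ᵀ * J + J * X = 0 ∧ Matrix.trace X = 0) :
    IsClosed (𝔲₀ : Set (Matrix (Fin 3) (Fin 3) K)) := by
  haveI : T2Space K := (IsNonarchimedeanLocalField.isLocalField K).toT2Space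
  have hlin : Continuous fun X : Matrix (Fin 3) (Fin 3) K => (X.map σ)ᵀ * J + J * X := by
    have hmap : Continuous fun X : Matrix (Fin 3) (Fin 3) K => X.map σ := continuous_id.matrix_map hσc
    exact (hmap.matrix_transpose.matrix_mul continuous_const).add (continuous_const.matrix_mul continuous_id)
  have : (𝔲₀ : Set (Matrix (Fin 3) (Fin 3) K)) =
      (fun X : Matrix (Fin 3) (Fin 3) K => (X.map σ)ᵀ * J + J * X) ⁻¹' {0} ∩ (fun X : Matrix (Fin 3) (Fin 3) K => Matrix.trace X) ⁻¹' {0} := by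
    ext X; rw [SetLike.mem_coe, h𝔲₀]; rfl
  rw [this]
  exact (isClosed_singleton.preimage hlin).inter (isClosed_singleton.preimage (continuous_id.matrix_trace))

/-- The coefficient group `A = {(c, d) | σ c = c ∧ σ d = −d} ≤ K × K` is closed when `σ` is continuous. [cite: Folland1999, §11.1 Thm. 11.9] -/
theorem isClosed_coeffGroup {σ : K →+* K} (hσc : Continuous σ)
    (A : AddSubgroup (K × K)) (hA : ∀ p : K × K, p ∈ A ↔ σ p.1 = p.1 ∧ σ p.2 = -p.2) :
    IsClosed (A : Set (K × K)) := by
  haveI : T2Space K := (IsNonarchimedeanLocalField.isLocalField K).toT2Space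
  have : (A : Set (K × K)) = {p : K × K | σ p.1 = p.1} ∩ {p : K × K | σ p.2 = -p.2} := by
    ext p; rw [SetLike.mem_coe, hA]; rfl
  rw [this]
  exact (isClosed_eq (hσc.comp continuous_fst) continuous_fst).inter (isClosed_eq (hσc.comp continuous_snd) continuous_snd.neg)

/-- **GLOBAL-FINAL GLUE (ROAD «HC-D»).**  For the R3 carriers (`K` a non-archimedean local field, `σ` a continuous involution, `J` `σ`-hermitian with invertible
determinant, `(2 : K) ≠ 0`, `(3 : K) ≠ 0`, a skew unit `lam`; `𝔲`, `𝔲₀` with ANY add-Haar measures `μ`, `μ₀`; the coefficient group `↥A` with ANY add-Haar measure `ν`) and the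
(CO)∕(NB) coordinate letters (`ι`, `hιn`, `Φ₀`, `hΦ₀`): IF the cusp integrand is locally `∫⁻`-finite on `↥A` (`hcusp`, road brick (HC)) AND `ηι` is locally `∫⁻`-finite at every
non-zero SQUARE-ZERO point of `↥𝔲₀` (`hsq`, D5(iii)) and at every SPLIT SEMISIMPLE NON-SCALAR point of `↥𝔲₀` (`hss`, D5(ii)) — hypotheses in the letters of the (NG) disjuncts —
THEN `ηι = |η|^{−1∕2}` is locally `∫⁻`-finite at every point of `↥𝔲`.  Proof: ★ GLOBAL §4 with `hreg :=` ★ D5(i) and `hnonreg` split by ★ (NG).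
[cite: HarishChandra1970, Part VII §1 Thm. 15] [cite: Folland1999, §11.1 Thm. 11.9] -/
theorem forall_exists_nhds_setLIntegral_etaInv_lt_top_of_cusp
    (σ : K →+* K) (hσ : ∀ x, σ (σ x) = x) (hσc : Continuous σ)
    {J : Matrix (Fin 3) (Fin 3) K} (hJσ : (J.map σ)ᵀ = J) (hJd : IsUnit J.det) (h2 : (2 : K) ≠ 0) (h3 : (3 : K) ≠ 0)
    (lam : Kˣ) (hlam : σ (lam : K) = -(lam : K))
    (𝔲 : AddSubgroup (Matrix (Fin 3) (Fin 3) K)) (h𝔲 : ∀ X, X ∈ 𝔲 ↔ (X.map σ)ᵀ * J + J * X = 0)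
    (𝔲₀ : AddSubgroup (Matrix (Fin 3) (Fin 3) K)) (h𝔲₀ : ∀ X, X ∈ 𝔲₀ ↔ (X.map σ)ᵀ * J + J * X = 0 ∧ Matrix.trace X = 0)
    [MeasurableSpace ↥𝔲₀] [BorelSpace ↥𝔲₀] (μ₀ : Measure ↥𝔲₀) [μ₀.IsAddHaarMeasure]
    [MeasurableSpace ↥𝔲] [BorelSpace ↥𝔲] (μ : Measure ↥𝔲) [μ.IsAddHaarMeasure]
    (A : AddSubgroup (K × K)) (hA : ∀ p : K × K, p ∈ A ↔ σ p.1 = p.1 ∧ σ p.2 = -p.2)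
    [MeasurableSpace ↥A] [BorelSpace ↥A] (ν : Measure ↥A) [ν.IsAddHaarMeasure]
    (hcusp : ∀ a₀ : ↥A, ∃ W ∈ 𝓝 a₀, ∫⁻ a in W,
      ((NNReal.sqrt (NNReal.sqrt (IsNonarchimedeanLocalField.normAbs K (-4 * (a : K × K).1 ^ 3 - 27 * (a : K × K).2 ^ 2))) : ℝ≥0∞))⁻¹ ∂ν < ∞)
    {F' : Type*} [Field F'] [ValuativeRel F'] [TopologicalSpace F'] [IsNonarchimedeanLocalField F']
    (ι : F' →+* K) (hιn : ∀ x : F', IsNonarchimedeanLocalField.normAbs K (ι x) = IsNonarchimedeanLocalField.normAbs F' x ^ 2)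
    (Φ₀ : (Fin 8 → F') ≃ₜ+ ↥𝔲₀)
    (hΦ₀ : ∀ (l : F') (a : Fin 8 → F'), ((Φ₀ (l • a) : ↥𝔲₀) : Matrix (Fin 3) (Fin 3) K) = ι l • ((Φ₀ a : ↥𝔲₀) : Matrix (Fin 3) (Fin 3) K))
    (hsq : ∀ X₀ : ↥𝔲₀, X₀ ≠ 0 → (X₀ : Matrix (Fin 3) (Fin 3) K) * (X₀ : Matrix (Fin 3) (Fin 3) K) = 0 →
      ∃ U ∈ 𝓝 X₀, ∫⁻ X in U, ((NNReal.sqrt (NNReal.sqrt (IsNonarchimedeanLocalField.normAbs K (Matrix.charpoly (X : Matrix (Fin 3) (Fin 3) K)).discr)) : ℝ≥0∞))⁻¹ ∂μ₀ < ∞)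
    (hss : ∀ X₀ : ↥𝔲₀, (∃ a b : K, a ≠ b ∧ ((X₀ : Matrix (Fin 3) (Fin 3) K) - a • (1 : Matrix (Fin 3) (Fin 3) K)) * ((X₀ : Matrix (Fin 3) (Fin 3) K) - b • 1) = 0 ∧
        ∀ c : K, (X₀ : Matrix (Fin 3) (Fin 3) K) ≠ c • 1) →
      ∃ U ∈ 𝓝 X₀, ∫⁻ X in U, ((NNReal.sqrt (NNReal.sqrt (IsNonarchimedeanLocalField.normAbs K (Matrix.charpoly (X : Matrix (Fin 3) (Fin 3) K)).discr)) : ℝ≥0∞))⁻¹ ∂μ₀ < ∞) :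
    ∀ X₀ : ↥𝔲, ∃ U ∈ 𝓝 X₀,
      ∫⁻ X in U, ((NNReal.sqrt (NNReal.sqrt (IsNonarchimedeanLocalField.normAbs K (Matrix.charpoly (X : Matrix (Fin 3) (Fin 3) K)).discr)) : ℝ≥0∞))⁻¹ ∂μ < ∞ := by
  have h𝔲₀c : IsClosed (𝔲₀ : Set (Matrix (Fin 3) (Fin 3) K)) := isClosed_traceZero hσc J 𝔲₀ h𝔲₀
  have hAc : IsClosed (A : Set (K × K)) := isClosed_coeffGroup hσc A hA
  refine forall_exists_nhds_setLIntegral_etaInv_lt_top_of_local hσc hJd h3 𝔲 h𝔲 𝔲₀ h𝔲₀ μ₀ μ ι hιn Φ₀ hΦ₀ ?_ ?_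
  · -- regular points: ★ D5(i)
    intro X₀ hli
    exact exists_nhds_setLIntegral_etaIota_lt_top σ hσ hJσ hJd h2 lam hlam 𝔲₀ h𝔲₀ h𝔲₀c μ₀ A hA hAc ν hcusp X₀ hli
  · -- non-regular points: the (NG) switch
    intro X₀ hX₀ hnr
    have htr : Matrix.trace (X₀ : Matrix (Fin 3) (Fin 3) K) = 0 := ((h𝔲₀ _).1 X₀.2).2
    have h0 : (X₀ : Matrix (Fin 3) (Fin 3) K) ≠ 0 := fun h => hX₀ (Subtype.ext h)
    rcases mul_self_eq_zero_or_splitSemisimple_of_trace_eq_zero h3 htr h0 hnr with hN | hS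
    · exact hsq X₀ hX₀ hN
    · exact hss X₀ hS

end Summit.HodgeConjecture.HodgeConjecture.Cruxes.H413.F0P3cStCharTSHCDLieGlobalFinal

end
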